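import Summits.BirchSwinnertonDyer.BirchSwinnertonDyer.Theorems.PrintCf2RubinValueTwoKatzFrameSupply
import Summits.BirchSwinnertonDyer.BirchSwinnertonDyer.Theorems.CycTangentCMCycTangentBoundSplitPrimeSaturation
import Summits.BirchSwinnertonDyer.BirchSwinnertonDyer.Theorems.PrintCf2SplitBadTwoFrameFieldArithmetic
import Literature.NumberTheory.GaloisRepresentations.EverywhereUnramifiedAlgebraicHeckeCharacter
import Literature.NumberTheory.GaloisRepresentations.DecompositionGroupOfCompletion
import Literature.NumberTheory.EllipticCurves.DeShalit1987.KatzMeasureFromDistribution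
import HarnessLib

set_option linter.dupNamespace false
set_option autoImplicit false

/-!
# THE `(−N, 0)`-POWERS THROUGH A GENERATOR PAIR, `j = 0` FORM: avatars `e ∘ χ₁ⁿ` of `Ψ₁^{Wn}` with value `1` at a
# generator `γ₂` in the inertia at `v̄` and node base `u = (e ∘ χ₁)(γ₁) ≠ 1`, `‖u − 1‖ < ‖p‖`

Cell `bsd-print-cf2`, width seat `bsd-line-cf2-p1-w7` g14, crux `PrintCf2.SplitBadTwoRankOneOfFacts` (stmt-20368), print leaf
24720 `KatzDistributionsAtTwoPrint` under director OPTION 1 (the `j = 0` twin); piece **S3** of LEAD g18's memo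
`Cruxes/KatzDistributionsAtTwoPrint/LEAD-MEMO-JZERO-RIGIDITY-g18.md` — the `t`-direction of the TORSION SUPPLY of the
frame socket `KatzPeriodRigidity.span_eq_span_of_isKatzMeasure₂₀_of_torsionSupply`.  `--supports stmt-BirchSwinnertonDyer-24720`
(helper, Theses-free).  THEOREMS ONLY (no `def`, no named fact, no `sorry`); nothing is closed; BSD is not proved by any of this;
no summit statement is proved by this seat.

WHAT.  Steps 1–2 of B18's `KatzPeriodRigidity.exists_frameSupply₂` VERBATIM (a type-`(w₀, 0)` character `η` ↦ its
everywhere-unramified inverse power `Ψ₁` of type `(−N, 0)` ↦ `CycTangentCMCycTangentBoundPairSupply.exists_isPAdicAvatarOf_pow_factorsThroughPair`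
↦ a power `χ₁` with values within `‖p‖` of `1`), plus the two facts the `j = 0` socket needs at a generator pair
`(κ₁, κ₂; γ₁, γ₂)` whose second generator lies in the inertia at `v̄`:

* (a) `(e ∘ χ₁ⁿ)(γ₂) = 1` — the avatar of a type-`(k, 0)` character unramified at `v̄` is UNRAMIFIED at `v̄`
  (`isUnramifiedAt_avatar_of_hasInfinityType_zero`, local algebraicity with weight `0` at `v̄`), and
  `γ₂ ∈ GreenbergSelmer.inertia vbar = I_{𝔓(v̄)}` (`inertia_adicCompletionPrime_eq_map_absInertia`);
* (b) `u := (e ∘ χ₁)(γ₁) ≠ 1` — otherwise `e ∘ χ₁` kills `γ₁`, `γ₂` and `Gal(K̄/K̃_∞)`, hence (continuity of the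
  descended character `pairChar` on `ℤ_p²`, density of `ℕ`) is trivial, hence unramified at `v`, contradicting
  `CycTangentCMCycTangentBoundAvatarRamified.not_isUnramifiedAt_avatar_of_hasInfinityType_ne_zero` (type `(−NW, 0)`, `NW ≠ 0`).

* §1 `avatarValueAt_eq_one_of_isUnramifiedAt_of_mem_inertia`, `unitsChar_eq_one_of_pair` (the two tools).
* §2 ★★ `exists_powers_through_pair₀` (every prime `p`; binders: `K` imaginary quadratic, `p = v v̄`, `ι ↔ v`, a type-`(w₀,0)`
  character `η`, a generator pair with `γ₂ ∈ GreenbergSelmer.inertia vbar`) — ONE ∃-block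
  `∃ Ψ₁ χ₁ N W u, 0 < N ∧ 0 < W ∧ ‖u − 1‖ < ‖p‖ ∧ u ≠ 1 ∧ ∀ n, IsPAdicAvatarOf ι (Ψ₁^(W n)) (e ∘ χ₁ⁿ) ∧
  FactorsThroughPair κ₁ κ₂ (e ∘ χ₁ⁿ) ∧ (Ψ₁^(W n)) of type (−N W n, 0) ∧ (∀ w, (Ψ₁^(W n)).IsUnramifiedAt w) ∧
  (e ∘ χ₁ⁿ)(γ₁) = uⁿ ∧ (e ∘ χ₁ⁿ)(γ₂) = 1`.
* §3 ★ `exists_powers_through_pair₀_DA7` — the same on the DA7 binders of line `m_line_pin` at `p = 2` (`√−7 ∈ K`, so `h_K = 1` and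
  `η := Ψ` of type `(w_K, 0)` exists by `HeckeCharacter.exists_hasInfinityType_torsionOrder_unramified`).

References: [deShalit1987] II.4.12 Remarks (iii)–(iv) (p. 66–67), II.4.16 (49)–(50) (p. 76–77), II.4.17 (52)–(54) (p. 77–78);
[Washington1997] §13.1; [SerreAbelianLadic1968] Ch. III §2.3.
-/

noncomputable section

open scoped NumberField Classical Topology
open Filter NumberField IsDedekindDomain Field
open Literature Literature.NumberTheory.GaloisRepresentations Literature.NumberTheory.EllipticCurves
open Summit.BirchSwinnertonDyer.Rank1Residual.X11b Summit.BirchSwinnertonDyer.Rank1Residual.X11b.LambdaSupply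
  Summit.BirchSwinnertonDyer.Rank1Residual.X11b.Three.LambdaSupply Summit.BirchSwinnertonDyer.BirchSwinnertonDyer.Theorems.PrintCf2
  Summit.BirchSwinnertonDyer.BirchSwinnertonDyer.Theorems.CycTangentCMCycTangentBoundUniquenessLines

namespace Summit.BirchSwinnertonDyer.BirchSwinnertonDyer.Theorems.PrintCf2.KatzPeriodRigidity

variable {p : ℕ} [Fact p.Prime] {K : Type} [Field K] [NumberField K]

/-! ## §1 Two tools -/

/-- If the rank-one `r` is unramified at `w` then `r(γ) = 1` (read in `ℂ_p`) at every `γ` of the CHOSEN inertia group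
`GreenbergSelmer.inertia w = I_{𝔓(w)}` (`𝔓(w)` the prime of `\bar ℤ_K` cut out by the completion at `w`).
[cite: SerreAbelianLadic1968, Ch. III §2.3] [cite: NeukirchANT1999, Ch. II §9 (9.6)] -/
theorem avatarValueAt_eq_one_of_isUnramifiedAt_of_mem_inertia {r : FramedGaloisRep K (PadicAlgCl p) 1}
    {w : HeightOneSpectrum (𝓞 K)} (hr : r.IsUnramifiedAt w) {γ : absoluteGaloisGroup K}
    (hγ : γ ∈ GreenbergSelmer.inertia w) : avatarValueAt r γ = 1 := by
  have e : GreenbergSelmer.inertia w = (adicCompletionPrime K w).inertia (absoluteGaloisGroup K) :=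
    (inertia_adicCompletionPrime_eq_map_absInertia K w).symm
  rw [e] at hγ
  rw [avatarValueAt, hr _ (adicCompletionPrime_mem_primesAbove K w) γ hγ]
  simp

omit [NumberField K] in
/-- **A character through a generator pair is determined by its two generator values**: if `e ∘ χ` factors through
`(κ₁, κ₂)` and `(e ∘ χ)(γ₁) = (e ∘ χ)(γ₂) = 1` at a generator pair, then `χ = 1` (the descended character `pairChar` on
`ℤ_p²` is continuous and additive-to-multiplicative, and `ℕ` is dense in `ℤ_p`). [cite: Washington1997, §13.1]
[cite: deShalit1987, II.4.17 (54) (p. 78)] -/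
theorem unitsChar_eq_one_of_pair [CharZero K] {κ₁ κ₂ : ZpExtension K p} {γ₁ γ₂ : absoluteGaloisGroup K}
    (hpair : ZpExtension.IsTopGeneratorPair κ₁ κ₂ γ₁ γ₂) (χ : absoluteGaloisGroup K →ₜ* (PadicAlgCl p)ˣ)
    (hχ : FactorsThroughPair κ₁ κ₂ ((FramedRep.unitsContinuousMulEquivOfUnique (Fin 1) (PadicAlgCl p) :
      (PadicAlgCl p)ˣ →ₜ* GL (Fin 1) (PadicAlgCl p)).comp χ))
    (h₁ : avatarValueAt ((FramedRep.unitsContinuousMulEquivOfUnique (Fin 1) (PadicAlgCl p) :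
      (PadicAlgCl p)ˣ →ₜ* GL (Fin 1) (PadicAlgCl p)).comp χ) γ₁ = 1)
    (h₂ : avatarValueAt ((FramedRep.unitsContinuousMulEquivOfUnique (Fin 1) (PadicAlgCl p) :
      (PadicAlgCl p)ˣ →ₜ* GL (Fin 1) (PadicAlgCl p)).comp χ) γ₂ = 1)
    (σ : absoluteGaloisGroup K) : χ σ = 1 := by
  set e := (FramedRep.unitsContinuousMulEquivOfUnique (Fin 1) (PadicAlgCl p) :
    (PadicAlgCl p)ˣ →ₜ* GL (Fin 1) (PadicAlgCl p)) with he
  have hind := hpair.isIndependent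
  set F := ZpExtension.pairChar hind (e.comp χ) with hF
  have hFc : Continuous F := ZpExtension.continuous_pairChar hind hχ
  have hFadd : ∀ a b, F (a + b) = F a * F b := ZpExtension.pairChar_add hind hχ
  have hF10 : F (1, 0) = 1 := by rw [hF, ZpExtension.pairChar_one_zero hχ hpair hind, h₁]
  have hF01 : F (0, 1) = 1 := by rw [hF, ZpExtension.pairChar_zero_one hχ hpair hind, h₂]
  -- `F (n, 0) = 1` and `F (0, n) = 1` for `n : ℕ`
  have hnat₁ : ∀ n : ℕ, F ((n : ℤ_[p]), 0) = 1 := by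
    intro n
    induction n with
    | zero => rw [Nat.cast_zero, Prod.mk_zero_zero, hF]; exact ZpExtension.pairChar_zero hind hχ
    | succ n ih =>
      have : (((n + 1 : ℕ) : ℤ_[p]), (0 : ℤ_[p])) = (((n : ℕ) : ℤ_[p]), (0 : ℤ_[p])) + ((1 : ℤ_[p]), 0) := by
        ext <;> simp
      rw [this, hFadd, ih, hF10, one_mul]
  have hnat₂ : ∀ n : ℕ, F (0, (n : ℤ_[p])) = 1 := by
    intro n
    induction n with
    | zero => rw [Nat.cast_zero, Prod.mk_zero_zero, hF]; exact ZpExtension.pairChar_zero hind hχ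
    | succ n ih =>
      have : ((0 : ℤ_[p]), ((n + 1 : ℕ) : ℤ_[p])) = ((0 : ℤ_[p]), ((n : ℕ) : ℤ_[p])) + (0, (1 : ℤ_[p])) := by
        ext <;> simp
      rw [this, hFadd, ih, hF01, one_mul]
  -- density of `ℕ` in `ℤ_p`
  have hall₁ : ∀ a : ℤ_[p], F (a, 0) = 1 := by
    have hc : Continuous fun a : ℤ_[p] ↦ F (a, 0) := hFc.comp (Continuous.prodMk_left (0 : ℤ_[p]))
    have heq := Continuous.ext_on (PadicInt.denseRange_natCast (p := p)) hc continuous_const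
      (fun x ⟨n, hn⟩ ↦ by subst hn; exact hnat₁ n)
    exact fun a ↦ congrFun heq a
  have hall₂ : ∀ b : ℤ_[p], F (0, b) = 1 := by
    have hc : Continuous fun b : ℤ_[p] ↦ F (0, b) := hFc.comp (Continuous.prodMk_right (0 : ℤ_[p]))
    have heq := Continuous.ext_on (PadicInt.denseRange_natCast (p := p)) hc continuous_const
      (fun x ⟨n, hn⟩ ↦ by subst hn; exact hnat₂ n)
    exact fun b ↦ congrFun heq b
  have hval : avatarValueAt (e.comp χ) σ = 1 := by
    rw [← ZpExtension.pairChar_pairCoord hind hχ σ, ZpExtension.pairCoord_apply]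
    have : (Multiplicative.toAdd (κ₁ σ), Multiplicative.toAdd (κ₂ σ)) =
        (Multiplicative.toAdd (κ₁ σ), (0 : ℤ_[p])) + (0, Multiplicative.toAdd (κ₂ σ)) := by ext <;> simp
    rw [← hF, this, hFadd, hall₁, hall₂, one_mul]
  rw [he, avatarValueAt_unitsChar, ← UniformSpace.Completion.coe_one, UniformSpace.Completion.coe_inj] at hval
  exact Units.ext hval

/-! ## §2 The `(−N, 0)`-powers through the pair, `j = 0` form -/

/-- ★★ **THE `(−N,0)`-POWERS THROUGH A GENERATOR PAIR, `j = 0` FORM** (every prime `p`).  `K` imaginary quadratic, `p = v v̄`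
(`v̄ ≠ v`), `ι` pinned to `v` (`hι`), a Hecke character `η` of infinity type `(w₀, 0)`, `w₀ > 0`, a generator pair
`(κ₁, κ₂; γ₁, γ₂)` with `γ₂ ∈ GreenbergSelmer.inertia vbar`.  Then there are: `Ψ₁` (`= (η^{N₁})⁻¹`, type `(−N, 0)`,
unramified EVERYWHERE), a continuous `χ₁ : Γ_K → ℚ̄_pˣ`, `N, W > 0` and `u ∈ ℂ_p` with `‖u − 1‖ < ‖p‖`, `u ≠ 1`, such that for
every `n`: `e ∘ χ₁ⁿ` is the `p`-adic avatar of `Ψ₁^{Wn}` and factors through the pair, `Ψ₁^{Wn}` has type `(−N W n, 0)` and is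
unramified everywhere, `(e ∘ χ₁ⁿ)(γ₁) = uⁿ` and `(e ∘ χ₁ⁿ)(γ₂) = 1` — the `t`-direction of the `j = 0` torsion supply (nodes
`w₁uᵗ − 1` along `γ₁`, constant `w₂` along `γ₂ ∈ I_v̄`).  Steps 1–2 are B18's `exists_frameSupply₂` verbatim; (a) is local
algebraicity with weight `0` at `v̄`; (b) is «trivial at `γ₁`, `γ₂`, `Gal(K̄/K̃_∞)` ⟹ trivial ⟹ unramified at `v`», impossible for
type `(−NW, 0)`. [cite: deShalit1987, II.4.12 Remarks (iii)–(iv) (p. 66–67), II.4.16 (49)–(50) (p. 76–77), II.4.17 (52)–(54) (p. 77–78)]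
[cite: SerreAbelianLadic1968, Ch. III §2.3] [cite: Washington1997, §13.1] -/
theorem exists_powers_through_pair₀ (hK : IsImaginaryQuadratic K)
    (ι : PadicAlgCl p ≃+* ℂ) {v vbar : HeightOneSpectrum (𝓞 K)}
    (hv : ((p : ℕ) : 𝓞 K) ∈ v.asIdeal) (hvbar : ((p : ℕ) : 𝓞 K) ∈ vbar.asIdeal) (hne : vbar ≠ v)
    (hι : ∀ (w : InfinitePlace K) (d : 𝓞 K), d ∈ v.asIdeal ↔ ‖ι.symm (w.embedding (d : K))‖ < 1)
    {η : HeckeCharacter K} {w₀ : ℕ} (hw₀ : 0 < w₀) (hη : η.HasInfinityType (fun _ ↦ (w₀ : ℤ)) (fun _ ↦ 0))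
    {κ₁ κ₂ : ZpExtension K p} {γ₁ γ₂ : absoluteGaloisGroup K}
    (hpair : ZpExtension.IsTopGeneratorPair κ₁ κ₂ γ₁ γ₂) (hγ₂ : γ₂ ∈ GreenbergSelmer.inertia vbar) :
    ∃ (Ψ₁ : HeckeCharacter K) (χ₁ : absoluteGaloisGroup K →ₜ* (PadicAlgCl p)ˣ) (N W : ℕ) (u : ℂ_[p]),
      0 < N ∧ 0 < W ∧ ‖u - 1‖ < ‖(p : ℂ_[p])‖ ∧ u ≠ 1 ∧
      ∀ n : ℕ,
        IsPAdicAvatarOf ι (Ψ₁ ^ (W * n))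
          ((FramedRep.unitsContinuousMulEquivOfUnique (Fin 1) (PadicAlgCl p) :
            (PadicAlgCl p)ˣ →ₜ* GL (Fin 1) (PadicAlgCl p)).comp (χ₁ ^ n)) ∧
        FactorsThroughPair κ₁ κ₂
          ((FramedRep.unitsContinuousMulEquivOfUnique (Fin 1) (PadicAlgCl p) :
            (PadicAlgCl p)ˣ →ₜ* GL (Fin 1) (PadicAlgCl p)).comp (χ₁ ^ n)) ∧
        (Ψ₁ ^ (W * n)).HasInfinityType (fun _ ↦ -((N * (W * n) : ℕ) : ℤ)) (fun _ ↦ 0) ∧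
        (∀ w : HeightOneSpectrum (𝓞 K), (Ψ₁ ^ (W * n)).IsUnramifiedAt w) ∧
        avatarValueAt ((FramedRep.unitsContinuousMulEquivOfUnique (Fin 1) (PadicAlgCl p) :
            (PadicAlgCl p)ˣ →ₜ* GL (Fin 1) (PadicAlgCl p)).comp (χ₁ ^ n)) γ₁ = u ^ n ∧
        avatarValueAt ((FramedRep.unitsContinuousMulEquivOfUnique (Fin 1) (PadicAlgCl p) :
            (PadicAlgCl p)ˣ →ₜ* GL (Fin 1) (PadicAlgCl p)).comp (χ₁ ^ n)) γ₂ = 1 := by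
  haveI : Algebra.IsQuadraticExtension ℚ K := ⟨hK.1⟩
  have himag : ∀ w : InfinitePlace K, w.IsComplex := fun w ↦ hK.2.isComplex w
  have hp : p.Prime := Fact.out
  set e := (FramedRep.unitsContinuousMulEquivOfUnique (Fin 1) (PadicAlgCl p) :
    (PadicAlgCl p)ˣ →ₜ* GL (Fin 1) (PadicAlgCl p)) with he
  -- Step 1 (B18 verbatim): `Ψ₁ = η^{-N₁}`, type `(-N, 0)` with `N = N₁ w₀`, unramified everywhere
  obtain ⟨N₁, hN₁, hηN⟩ := exists_pow_forall_isUnramifiedAt η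
  set N : ℕ := N₁ * w₀ with hNdef
  have hN : 0 < N := Nat.mul_pos hN₁ hw₀
  set Ψ₁ : HeckeCharacter K := (η ^ N₁)⁻¹ with hΨ₁
  have hΨ₁t : Ψ₁.HasInfinityType (fun _ ↦ -(N : ℤ)) (fun _ ↦ 0) := by
    have h := (HasInfinityType.pow_nat hη N₁).inv
    convert h using 2 <;> simp [hNdef]
  have hΨ₁a : Ψ₁.IsAlgebraic :=
    (HeckeCharacter.isAlgebraic_iff_exists_hasInfinityType _).mpr ⟨_, _, hΨ₁t⟩
  have hΨ₁u : ∀ w : HeightOneSpectrum (𝓞 K), Ψ₁.IsUnramifiedAt w := fun w ↦ (hηN w).inv'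
  have hΨ₁pow_t : ∀ n : ℕ, (Ψ₁ ^ n).HasInfinityType (fun _ ↦ -((N * n : ℕ) : ℤ)) (fun _ ↦ 0) := by
    intro n
    have h := HasInfinityType.pow_nat hΨ₁t n
    convert h using 2 <;> push_cast <;> ring
  have hΨ₁pow_u : ∀ (n : ℕ) (w : HeightOneSpectrum (𝓞 K)), (Ψ₁ ^ n).IsUnramifiedAt w :=
    fun n w ↦ isUnramifiedAt_pow' (hΨ₁u w) n
  -- Step 2 (B18 verbatim): avatars of the powers of `Ψ₁` through the pair, tamed
  obtain ⟨M, χ₀, hM, hall⟩ := CycTangentCMCycTangentBoundPairSupply.exists_isPAdicAvatarOf_pow_factorsThroughPair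
    ι hK.1 himag hΨ₁a (fun w _ ↦ hΨ₁u w) hpair
  obtain ⟨N₀, hN₀, hsmall₀⟩ := exists_pow_norm_sub_one_lt χ₀
  set χ₁ : absoluteGaloisGroup K →ₜ* (PadicAlgCl p)ˣ := χ₀ ^ N₀ with hχ₁
  set W : ℕ := M * N₀ with hW
  have hWpos : 0 < W := Nat.mul_pos hM hN₀
  have havatar : ∀ n : ℕ, IsPAdicAvatarOf ι (Ψ₁ ^ (W * n)) (e.comp (χ₁ ^ n)) := by
    intro n
    have h := (hall (N₀ * n)).1
    rw [hχ₁, ← pow_mul, hW, mul_assoc]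
    exact h
  have hpair_n : ∀ n : ℕ, FactorsThroughPair κ₁ κ₂ (e.comp (χ₁ ^ n)) := by
    intro n
    rw [hχ₁, ← pow_mul]
    exact (hall (N₀ * n)).2
  have hsmall : ∀ (n : ℕ) (σ : absoluteGaloisGroup K),
      ‖avatarValueAt (e.comp (χ₁ ^ n)) σ - 1‖ < ‖(p : ℂ_[p])‖ := by
    intro n σ
    rw [he, avatarValueAt_unitsChar_pow]
    exact (UnrUnits.norm_pow_sub_one_le (norm_avatarValueAt_eq_one _ σ).le n).trans_lt (hsmall₀ σ)
  have htype : ∀ n : ℕ, (Ψ₁ ^ (W * n)).HasInfinityType (fun _ ↦ -((N * (W * n) : ℕ) : ℤ)) (fun _ ↦ 0) :=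
    fun n ↦ hΨ₁pow_t (W * n)
  -- (a) value `1` at `γ₂ ∈ I_v̄`: the avatar of a type-`(k, 0)` character unramified at `v̄` is unramified at `v̄`
  have hunr_vbar : ∀ n : ℕ, FramedGaloisRep.IsUnramifiedAt vbar (e.comp (χ₁ ^ n)) := fun n ↦
    isUnramifiedAt_avatar_of_hasInfinityType_zero ι himag hvbar hne hι (htype n) (T := ∅)
      (fun w _ ↦ hΨ₁pow_u _ w) (hΨ₁pow_u _ vbar) (havatar n)
  have hγ₂val : ∀ n : ℕ, avatarValueAt (e.comp (χ₁ ^ n)) γ₂ = 1 := fun n ↦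
    avatarValueAt_eq_one_of_isUnramifiedAt_of_mem_inertia (hunr_vbar n) hγ₂
  -- the node base `u`
  set u : ℂ_[p] := avatarValueAt (e.comp χ₁) γ₁ with hudef
  have hγ₁val : ∀ n : ℕ, avatarValueAt (e.comp (χ₁ ^ n)) γ₁ = u ^ n := fun n ↦ by
    rw [hudef, he, avatarValueAt_unitsChar_pow]
  have husmall : ‖u - 1‖ < ‖(p : ℂ_[p])‖ := by
    have h := hsmall 1 γ₁
    rwa [pow_one] at h
  -- (b) `u ≠ 1`
  have hune : u ≠ 1 := by
    intro hu1
    have h1 : avatarValueAt (e.comp (χ₁ ^ 1)) γ₁ = 1 := by rw [hγ₁val, pow_one, hu1]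
    have h2 : avatarValueAt (e.comp (χ₁ ^ 1)) γ₂ = 1 := hγ₂val 1
    have htriv : ∀ σ, (χ₁ ^ 1) σ = 1 := unitsChar_eq_one_of_pair hpair (χ₁ ^ 1) (hpair_n 1) h1 h2
    have hunrv : FramedGaloisRep.IsUnramifiedAt v (e.comp (χ₁ ^ 1)) := by
      intro 𝔓 _ τ _
      show e ((χ₁ ^ 1) τ) = 1
      rw [htriv τ, map_one]
    have hNW : (-((N * (W * 1) : ℕ) : ℤ)) ≠ 0 := by
      have : 0 < N * (W * 1) := Nat.mul_pos hN (by omega)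
      omega
    exact CycTangentCMCycTangentBoundAvatarRamified.not_isUnramifiedAt_avatar_of_hasInfinityType_ne_zero ι hK hv hvbar
      hne hι hNW (htype 1) (T := ∅) (fun w _ ↦ hΨ₁pow_u _ w) (hΨ₁pow_u _ v) (havatar 1) hunrv
  exact ⟨Ψ₁, χ₁, N, W, u, hN, hWpos, husmall, hune, fun n ↦
    ⟨havatar n, hpair_n n, htype n, fun w ↦ hΨ₁pow_u _ w, hγ₁val n, hγ₂val n⟩⟩

/-! ## §3 The DA7 binders of line `m_line_pin` (`p = 2`, `√−7 ∈ K`) -/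

/-- ★ **S3 ON THE DA7 FRAME.** `K` imaginary quadratic with `√−7 ∈ K` (so `h_K = 1`), `2 = v v̄`, `ι` pinned to `v`, a generator
pair `(κ₁, κ₂; γ₁, γ₂)` with `γ₂ ∈ GreenbergSelmer.inertia vbar`: the `(−N,0)`-powers through the pair with value `1` at `γ₂` and
node base `u ≠ 1`, `‖u − 1‖ < ‖2‖` at `γ₁` — `η := Ψ`, de Shalit's everywhere-unramified character of type `(w_K, 0)` of the
class-number-one field (`HeckeCharacter.exists_hasInfinityType_torsionOrder_unramified`). [cite: deShalit1987, II.1.4 Lemma (ii), II.4.12 Remarks (iii)–(iv) (p. 66–67), II.4.17 (52)–(54) (p. 77–78)]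
[cite: Washington1997, §13.1] -/
theorem exists_powers_through_pair₀_DA7 (hK : IsImaginaryQuadratic K) {θ₇ : K} (hθ7 : θ₇ ^ 2 = -7)
    (ι : PadicAlgCl 2 ≃+* ℂ) {v vbar : HeightOneSpectrum (𝓞 K)}
    (hv : ((2 : ℕ) : 𝓞 K) ∈ v.asIdeal) (hvbar : ((2 : ℕ) : 𝓞 K) ∈ vbar.asIdeal) (hne : vbar ≠ v)
    (hι : ∀ (w : InfinitePlace K) (d : 𝓞 K), d ∈ v.asIdeal ↔ ‖ι.symm (w.embedding (d : K))‖ < 1)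
    {κ₁ κ₂ : ZpExtension K 2} {γ₁ γ₂ : absoluteGaloisGroup K}
    (hpair : ZpExtension.IsTopGeneratorPair κ₁ κ₂ γ₁ γ₂) (hγ₂ : γ₂ ∈ GreenbergSelmer.inertia vbar) :
    ∃ (Ψ₁ : HeckeCharacter K) (χ₁ : absoluteGaloisGroup K →ₜ* (PadicAlgCl 2)ˣ) (N W : ℕ) (u : ℂ_[2]),
      0 < N ∧ 0 < W ∧ ‖u - 1‖ < ‖(2 : ℂ_[2])‖ ∧ u ≠ 1 ∧
      ∀ n : ℕ,
        IsPAdicAvatarOf ι (Ψ₁ ^ (W * n))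
          ((FramedRep.unitsContinuousMulEquivOfUnique (Fin 1) (PadicAlgCl 2) :
            (PadicAlgCl 2)ˣ →ₜ* GL (Fin 1) (PadicAlgCl 2)).comp (χ₁ ^ n)) ∧
        FactorsThroughPair κ₁ κ₂
          ((FramedRep.unitsContinuousMulEquivOfUnique (Fin 1) (PadicAlgCl 2) :
            (PadicAlgCl 2)ˣ →ₜ* GL (Fin 1) (PadicAlgCl 2)).comp (χ₁ ^ n)) ∧
        (Ψ₁ ^ (W * n)).HasInfinityType (fun _ ↦ -((N * (W * n) : ℕ) : ℤ)) (fun _ ↦ 0) ∧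
        (∀ w : HeightOneSpectrum (𝓞 K), (Ψ₁ ^ (W * n)).IsUnramifiedAt w) ∧
        avatarValueAt ((FramedRep.unitsContinuousMulEquivOfUnique (Fin 1) (PadicAlgCl 2) :
            (PadicAlgCl 2)ˣ →ₜ* GL (Fin 1) (PadicAlgCl 2)).comp (χ₁ ^ n)) γ₁ = u ^ n ∧
        avatarValueAt ((FramedRep.unitsContinuousMulEquivOfUnique (Fin 1) (PadicAlgCl 2) :
            (PadicAlgCl 2)ˣ →ₜ* GL (Fin 1) (PadicAlgCl 2)).comp (χ₁ ^ n)) γ₂ = 1 := by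
  haveI : IsTotallyComplex K := hK.2
  haveI : IsPrincipalIdealRing (𝓞 K) := FirstLayer.isPrincipalIdealRing_of_sq_eq_neg_seven hK hθ7
  obtain ⟨Ψ, hΨt, -⟩ := HeckeCharacter.exists_hasInfinityType_torsionOrder_unramified (K := K) hK.1
  have hw₀ : 0 < Units.torsionOrder K := Units.torsionOrder_pos K
  have hp2 : ‖((2 : ℕ) : ℂ_[2])‖ = ‖(2 : ℂ_[2])‖ := by norm_num
  obtain ⟨Ψ₁, χ₁, N, W, u, hN, hW, hu, hune, hall⟩ :=
    exists_powers_through_pair₀ (p := 2) hK ι hv hvbar hne hι hw₀ hΨt hpair hγ₂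
  exact ⟨Ψ₁, χ₁, N, W, u, hN, hW, by simpa using hu, hune, hall⟩

end Summit.BirchSwinnertonDyer.BirchSwinnertonDyer.Theorems.PrintCf2.KatzPeriodRigidity

end
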